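import Mathlib
import Summits.NavierStokesRegularity.NavierStokesRegularity.Theses.TaoLadderRungThree
import Summits.NavierStokesRegularity.NavierStokesRegularity.Theorems.TaoLadderRungThreeTargetTableScaling
import Literature.Analysis.FluidPDE.TaoCascadeODEProofs
import Literature.Analysis.FluidPDE.TaoCascadeBlowupDynamicsHolds
import HarnessLib

/-!
# `TaoLadderRungThree.Target` follows from Tao's Theorem 6.2 at the dyadic scale ratio
  (item stmt-NavierStokesRegularity-20421 served; MODEL lattice statements only)

**What this file proves (kernel).**

* `noGlobalCascade_taoCoeff_of_thm62` — the inner statement of Tao's Theorem 6.2 at `(ε₀, K, ε)`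
  (no global solution of the system (6.0)–(6.8), `TaoCascade.TaoODESystem`) gives Theorem 4.2-level
  blow-up `NoGlobalCascade ε₀ (taoCoeff ε₀ K ε) 1_{mode 0}` for Table 1 (any `ε₀ > 0`).
* `exists_comparable_noGlobalCascade_of_thm62` — hence, for `0 < ε₀ ≤ 1`, SOME `R ≥ 1` and some
  `R`-comparable symmetric cancelling four-mode table (the max-normalised Table 1, spread
  `R = 16 K¹⁰ e^{K¹⁰} ε⁻⁴`, via `TaoLadderRungThreeTargetTableScaling`) with `NoGlobalCascade ε₀ α X₀`.
* `exists_comparable_noGlobalCascade_of_lt_one` — **UNCONDITIONAL**: for every `0 < ε₀ < 1` the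
  previous conclusion holds, by the tree's PROVED Theorem 6.2 `TaoCascade.noGlobalODESolution_holds`:
  a single-`ε₀`, existential-spread blow-up claim of this shape is a corollary of Tao's mechanism
  (the cell's rung M₂ fixes `R` BEFORE `ε₀ → 0`, which this does not give).
* `taoLadderRungThree_target_of_thm62_at_one` — **CONDITIONAL**: IF the inner statement of
  Theorem 6.2 holds AT `ε₀ = 1` (the tree types Theorem 6.2 with the printed range `ε₀ < 1`), THEN
  the rung leaf `TaoLadderRungThree.Target` (= `RungThreeLatt`: SOME `R ≥ 1`, some `R`-comparable
  table and one-shell datum with `NoGlobalCascade 1 α X₀`) holds — witnessed by Tao's own engineered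
  circuit, NOT by a table of bounded spread.

**Why it is here (cell harvest/h2-tao-ladder, p1 g11, 2026-08-27).** The rung leaf and the
certificate crux `DyadicGapCertificateV2` quantify the spread `R` EXISTENTIALLY at the single scale
ratio `ε₀ = 1`; this file records, kernel-checked, that the leaf AS TYPED is reducible to Tao's
blow-up mechanism at `λ = 2`. In the tree's proof of Theorem 6.2 the hypothesis `ε₀ < 1` is threaded
through the signatures but consumed only by numerical facts that remain true at `ε₀ = 1`
(`TaoCascade.hundred_le_of_regime`, `rpow_hundredth_le_two`, …); whether the rung of record should
carry an explicit spread bound, or the tree's Theorem 6.2 be re-typed for `ε₀ ≤ 1`, is for the cell's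
referee/planner. Nothing here closes or weakens any item.

HONEST FRAMING: statements about Tao's MODEL lattice ODE; nothing in this file is a statement about
the Navier–Stokes equations, and the conditional theorem's hypothesis is NOT proved here.
-/

noncomputable section

set_option linter.dupNamespace false

open Set MeasureTheory

namespace Summit.NavierStokesRegularity.NavierStokesRegularity.Theorems.RungThreeTaoMechanism

open Literature.Analysis.FluidPDE.TaoCascade

/-! ### The indicator datum -/

/-- A shell-supported family with the indicator amplitudes `1_{i₀}` is a single-wavelet family in
Tao's format (converse of `CascadeODESolution.toFrom`). [cite: Tao2016AveragedNS, §4 (4.4), (4.7)] -/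
theorem cascadeODESolution_of_from_indicator {ε₀ : ℝ} {m : ℕ} {i₀ : Fin m}
    {α : Fin m → Fin m → Fin m → ℤ × ℤ × ℤ → ℝ} {K₁ K₂ : ℝ} {n₀ : ℤ} {X E : Fin m → ℤ → ℝ → ℝ}
    (h : CascadeODESolutionFrom ε₀ α K₁ K₂ n₀ (fun i => if i = i₀ then 1 else 0) X E) :
    CascadeODESolution ε₀ i₀ α K₁ K₂ n₀ X E where
  contDiffOn_X := h.contDiffOn_X
  contDiffOn_E := h.contDiffOn_E
  nonneg_E := h.nonneg_E
  apriori_X := h.apriori_X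
  apriori_E := h.apriori_E
  init_E := h.init_E
  init_X i n := by
    rw [h.init_X]
    by_cases hi : i = i₀ <;> by_cases hn : n = n₀ <;> simp [hi, hn]
  motion := h.motion
  energy := h.energy
  defect_lower := h.defect_lower
  defect_upper := h.defect_upper
  noLow_X := h.noLow_X
  noLow_E := h.noLow_E

/-! ### From the inner statement of Theorem 6.2 to Theorem 4.2-level blow-up -/

/-- **The inner statement of Theorem 6.2 at `(ε₀, K, ε)` gives `NoGlobalCascade` for Table 1
with the indicator datum `1_{mode 0}`** (any `ε₀ > 0`): a global family obeying Lemma 4.1's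
conclusions for `taoCoeff ε₀ K ε` is, with combined energies `E_n = ∑ᵢ E_{i,n}`, a global solution
of the system (6.0)–(6.8) with the same implied constants (`CascadeODESolution.toTaoODESystem`).
[cite: Tao2016AveragedNS, §6.1 p. 31 ("to prove Theorem 4.2, it thus suffices to show Theorem 6.2")] -/
theorem noGlobalCascade_taoCoeff_of_thm62 {ε₀ K ε : ℝ} (hε₀ : 0 < ε₀)
    (he : ∀ C₁ C₂ : ℝ, 0 ≤ C₁ → 0 ≤ C₂ → ∃ N₀ : ℤ, ∀ n₀ : ℤ, N₀ ≤ n₀ →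
      ¬ ∃ (X : Fin 4 → ℤ → ℝ → ℝ) (E : ℤ → ℝ → ℝ), TaoODESystem ε₀ K ε C₁ C₂ n₀ X E) :
    NoGlobalCascade ε₀ (taoCoeff ε₀ K ε) (fun i => if i = (0 : Fin 4) then 1 else 0) := by
  intro K₁ K₂ hK₁ hK₂
  obtain ⟨N₀, hN₀⟩ := he K₁ K₂ hK₁ hK₂
  exact ⟨N₀, fun n₀ hn₀ ⟨X, E, hXE⟩ => hN₀ n₀ hn₀
    ⟨X, fun n t => ∑ i, E i n t, (cascadeODESolution_of_from_indicator hXE).toTaoODESystem hε₀ hK₁⟩⟩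

/-- **Single-`ε₀` comparable blow-up with EXISTENTIAL spread from the inner statement of
Theorem 6.2** (`0 < ε₀ ≤ 1`): if for `K ≥ K₀`, `0 < ε ≤ e₀(K)`, all implied constants and all large
`n₀` the system (6.0)–(6.8) has no global solution, then SOME `R ≥ 1`, some `R`-comparable symmetric
cancelling four-mode table (the normalised Table 1 with `K = max K₀ 1`, `ε = min e₀ 1`, spread
`R = 16 K¹⁰ e^{K¹⁰} ε⁻⁴`) and the indicator datum have `NoGlobalCascade ε₀ α X₀`.
[cite: Tao2016AveragedNS, §6.1 Thm. 6.2 and Table 1; cell vocabulary `InTableClass`, `NoGlobalCascade`] -/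
theorem exists_comparable_noGlobalCascade_of_thm62 {ε₀ : ℝ} (hε₀ : 0 < ε₀) (hε₀1 : ε₀ ≤ 1)
    (h62 : ∃ K₀ : ℝ, ∀ K : ℝ, K₀ ≤ K → 0 < K →
      ∃ e₀ : ℝ, 0 < e₀ ∧ ∀ ε : ℝ, 0 < ε → ε ≤ e₀ →
        ∀ C₁ C₂ : ℝ, 0 ≤ C₁ → 0 ≤ C₂ →
          ∃ N₀ : ℤ, ∀ n₀ : ℤ, N₀ ≤ n₀ →
            ¬ ∃ (X : Fin 4 → ℤ → ℝ → ℝ) (E : ℤ → ℝ → ℝ), TaoODESystem ε₀ K ε C₁ C₂ n₀ X E) :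
    ∃ R : ℝ, 1 ≤ R ∧ ∃ (α : Fin 4 → Fin 4 → Fin 4 → ℤ × ℤ × ℤ → ℝ) (X₀ : Fin 4 → ℝ),
      InTableClass R α ∧ NoGlobalCascade ε₀ α X₀ := by
  obtain ⟨K₀, hK₀⟩ := h62
  -- parameters: `K = max K₀ 1 ≥ 1`, `ε = min e₀ 1 ∈ (0, 1]`
  obtain ⟨K, hK_def⟩ : ∃ K : ℝ, K = max K₀ 1 := ⟨_, rfl⟩
  have hK1 : 1 ≤ K := hK_def ▸ le_max_right _ _
  have hK0 : 0 < K := lt_of_lt_of_le one_pos hK1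
  obtain ⟨e₀, he₀, he⟩ := hK₀ K (hK_def ▸ le_max_left _ _) hK0
  obtain ⟨ε, hε_def⟩ : ∃ ε : ℝ, ε = min e₀ 1 := ⟨_, rfl⟩
  have hε : 0 < ε := hε_def ▸ lt_min he₀ one_pos
  have hε1 : ε ≤ 1 := hε_def ▸ min_le_right _ _
  have hεe₀ : ε ≤ e₀ := hε_def ▸ min_le_left _ _
  refine ⟨(8 * K ^ 10 / ε ^ 2) / (ε ^ 2 * Real.exp (-K ^ 10) / 2), one_le_taoCoeff_spread hε hε1 hK1,
    fun a b d μ => (8 * K ^ 10 / ε ^ 2)⁻¹ * taoCoeff ε₀ K ε a b d μ,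
    fun i => if i = (0 : Fin 4) then 1 else 0,
    inTableClass_taoCoeff_scaled hε₀.le hε₀1 hε hε1 hK1, ?_⟩
  exact noGlobalCascade_tableScale hε₀ (by positivity)
    (noGlobalCascade_taoCoeff_of_thm62 hε₀ (he ε hε hεe₀))

/-- **UNCONDITIONAL below the dyadic ratio**: for every `0 < ε₀ < 1` some `R ≥ 1`, some
`R`-comparable symmetric cancelling four-mode table and one-shell datum have Theorem 4.2-level
blow-up `NoGlobalCascade ε₀ α X₀` — by the tree's PROVED Theorem 6.2
(`TaoCascade.noGlobalODESolution_holds`) and the normalised Table 1. This is the kernel witness that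
a single-`ε₀`, existential-spread claim of this shape is a corollary of Tao's mechanism; the cell's
rung M₂ fixes `R` BEFORE `ε₀ → 0`, which this does not give.
[cite: Tao2016AveragedNS, §6.1 Thm. 6.2 and Table 1, §4 Thm. 4.2] -/
theorem exists_comparable_noGlobalCascade_of_lt_one {ε₀ : ℝ} (hε₀ : 0 < ε₀) (hε₀1 : ε₀ < 1) :
    ∃ R : ℝ, 1 ≤ R ∧ ∃ (α : Fin 4 → Fin 4 → Fin 4 → ℤ × ℤ × ℤ → ℝ) (X₀ : Fin 4 → ℝ),
      InTableClass R α ∧ NoGlobalCascade ε₀ α X₀ :=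
  exists_comparable_noGlobalCascade_of_thm62 hε₀ hε₀1.le (noGlobalODESolution_holds ε₀ hε₀ hε₀1)

/-! ### The conditional reduction of the rung leaf -/

/-- **`TaoLadderRungThree.Target` from Tao's Theorem 6.2 at `ε₀ = 1` (CONDITIONAL).** If the inner
statement of Tao's Theorem 6.2 holds at the dyadic scale ratio — for `K ≥ K₀`, `0 < ε ≤ e₀(K)`,
all implied constants `C₁, C₂ ≥ 0` and all large `n₀` the system (6.0)–(6.8) with `ε₀ = 1` has no
global solution (`TaoCascade.TaoODESystem 1 K ε C₁ C₂ n₀`) — then SOME `R ≥ 1`, some `R`-comparable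
symmetric cancelling four-mode table (the max-normalised Table 1, spread `R = 16 K¹⁰ e^{K¹⁰} ε⁻⁴`)
and the indicator datum `1_{mode 0}` have `NoGlobalCascade 1 α X₀`, i.e. the rung leaf holds. The
tree proves the hypothesis for every `0 < ε₀ < 1` (`TaoCascade.noGlobalODESolution_holds`,
cf. `exists_comparable_noGlobalCascade_of_lt_one`), NOT at `ε₀ = 1`; this theorem is the kernel
record that the leaf as typed (spread `R` existential) asks for no more than Tao's mechanism at
`λ = 2`. [cite: Tao2016AveragedNS, §6.1 Thm. 6.2, Table 1, p. 31 ("to prove Theorem 4.2, it thus suffices to show Theorem 6.2")] -/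
theorem taoLadderRungThree_target_of_thm62_at_one
    (h62 : ∃ K₀ : ℝ, ∀ K : ℝ, K₀ ≤ K → 0 < K →
      ∃ e₀ : ℝ, 0 < e₀ ∧ ∀ ε : ℝ, 0 < ε → ε ≤ e₀ →
        ∀ C₁ C₂ : ℝ, 0 ≤ C₁ → 0 ≤ C₂ →
          ∃ N₀ : ℤ, ∀ n₀ : ℤ, N₀ ≤ n₀ →
            ¬ ∃ (X : Fin 4 → ℤ → ℝ → ℝ) (E : ℤ → ℝ → ℝ), TaoODESystem 1 K ε C₁ C₂ n₀ X E) :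
    Summit.NavierStokesRegularity.NavierStokesRegularity.Theses.TaoLadderRungThree.Target := by
  unfold Summit.NavierStokesRegularity.NavierStokesRegularity.Theses.TaoLadderRungThree.Target
  exact exists_comparable_noGlobalCascade_of_thm62 one_pos le_rfl h62

end Summit.NavierStokesRegularity.NavierStokesRegularity.Theorems.RungThreeTaoMechanism
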